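import Summits.Ventures.PercRepro.ProfilePointedUniformRestrictionRow

/-!
# PercRepro — A SET WITH MORE THAN TWICE ITS RANK ELEMENTS KILLS EVERY BI-INDEPENDENT SET: IN A MINIMAL (Ĉ)-WITNESS
EVERY SUBSET HAS AT MOST TWICE ITS RANK ELEMENTS (p10, gen 24; unconditional)

For `L ⊆ E` the two traces `X ∩ L` and `(E ∖ X) ∩ L` of a bi-independent set are independent subsets of `L`, so each has
at most `ρ(L)` elements, and they partition `L`: `#L ≤ 2·ρ(L)` as soon as one bi-independent set exists
(`card_le_two_mul_rk_of_mem_biIndepSets`).  Hence a set with `#L > 2·ρ(L)` — a `U_{r,s}`-restriction with `s ≥ 2r + 1`, a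
parallel class of three, five points of rank two, … — makes every profile vanish (`card_biIndepSets_eq_zero_of_two_mul_rk_lt`)
and (Ĉ) holds at every point of such a matroid outright (`pointedRowAt_of_two_mul_rk_lt`; no Theorem A).  A minimal
(Ĉ)-witness therefore satisfies `#L ≤ 2·ρ(L)` for EVERY subset `L` of its ground set (`MinimalWitness.card_le_two_mul_rk`),
in particular `#E ≤ 2·ρ(E)`; together with the `U_{r,2r}` / `U_{r,2r−1}` reductions of this gen: the only `U_{r,s}`-restrictions
of a minimal witness have `s ≤ 2r − 2`.  Nothing here asserts (Ĉ).
-/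

open scoped Matroid

namespace PercRepro.Cogirth

open Finset ThmH Skew

variable {α : Type} [DecidableEq α] {N : Matroid α} [N.Finite]

section dense

variable {L : Finset α}

/-- If some bi-independent set exists then `#L ≤ 2·ρ(L)` for every `L ⊆ E`: both traces of the set on `L` are
independent subsets of `L`, and they partition `L`. -/
theorem card_le_two_mul_rk_of_mem_biIndepSets (hL : L ⊆ gr N) {k : ℕ} {X : Finset α} (hX : X ∈ biIndepSets N k) :
    L.card ≤ 2 * rk N L := by
  rw [mem_biIndepSets] at hX
  obtain ⟨-, -, hXr, hXc⟩ := hX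
  have h1 : (X ∩ L).card ≤ rk N L := by
    rw [← rk_eq_card_of_subset_of_rk_eq_card inter_subset_left hXr]
    exact rk_mono' inter_subset_right
  have h2 : ((gr N \ X) ∩ L).card ≤ rk N L := by
    rw [← rk_eq_card_of_subset_of_rk_eq_card inter_subset_left hXc]
    exact rk_mono' inter_subset_right
  have h3 := card_inter_add_card_sdiff_inter hL X
  omega

/-- A set with more than twice its rank elements kills every bi-independent set. -/
theorem card_biIndepSets_eq_zero_of_two_mul_rk_lt (hL : L ⊆ gr N) (hbig : 2 * rk N L < L.card) (k : ℕ) :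
    (biIndepSets N k).card = 0 := by
  rw [card_eq_zero, eq_empty_iff_forall_notMem]
  intro X hX
  have := card_le_two_mul_rk_of_mem_biIndepSets hL hX
  omega

/-- **(Ĉ) holds outright at every point of a matroid with a subset of more than twice its rank elements**
(unconditional): every profile vanishes. -/
theorem pointedRowAt_of_two_mul_rk_lt (hL : L ⊆ gr N) (hbig : 2 * rk N L < L.card) (p : α) : PointedRowAt N p := by
  intro k _
  rw [card_biIndepSets_eq_zero_of_two_mul_rk_lt hL hbig k, mul_zero]
  exact Nat.zero_le _

/-- **EVERY SUBSET OF A MINIMAL (Ĉ)-WITNESS HAS AT MOST TWICE ITS RANK ELEMENTS** (unconditional): in particular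
no parallel class of three, no five points of rank two, no `U_{r,s}`-restriction with `s ≥ 2r + 1`, and `#E ≤ 2·ρ(E)`. -/
theorem MinimalWitness.card_le_two_mul_rk {p : α} (h : MinimalWitness N p) (hL : L ⊆ gr N) :
    L.card ≤ 2 * rk N L := by
  by_contra hbig
  exact h.2.1 (pointedRowAt_of_two_mul_rk_lt hL (by omega) p)

/-- The ground set of a minimal witness has at most twice the rank elements (unconditional). -/
theorem MinimalWitness.card_gr_le_two_mul_rk {p : α} (h : MinimalWitness N p) : (gr N).card ≤ 2 * rk N (gr N) :=
  h.card_le_two_mul_rk (subset_refl _)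

end dense

end PercRepro.Cogirth
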